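import Literature.Computability.Cryptography.SchemesProofs
import Literature.Computability.MetaComplexity.HeuristicClassesProofs
import HarnessLib

/-!
# One-query events of the chosen-message experiment factor through the first answer's coins

Topic `Literature/Computability/Cryptography`; companion of `CommitmentsSignatures.lean` (the
chosen-message experiment `SignatureScheme.cmaExpPMF`: the forger runs against the PROBABILISTIC
signing oracle `m ↦ S.sigPMF sk m`, fresh coins per query; `oneTimeForgeEvent`). Reductions from
ONE-TIME security (Goldreich 2004, §6.4: Prop. 6.4.5, Prop. 6.4.31, Prop. 6.4.15) are computed on
events contained in "at most one signing query"; on such events only the coins of the FIRST answer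
matter, and the experiment becomes a finite average over three coin strings — key-generation coins,
forger coins, first-signature coins — of the indicator of a DETERMINISTIC run:

* `OracleAlg.toOuterMeasure_probTranscriptAux_of_nil` — from a given transcript, the mass of an event
  all of whose members have NO (further) query is the indicator of the deterministic continuation
  (against any oracle);
* `OracleAlg.toOuterMeasure_probTranscript_of_le_one` — for an event with at most one query, when the
  first step of `M` on `x` is the query `q`: the mass under `M.probTranscript O (k+1) x` is the mass of
  the push-forward, under ANY law `P` of "first-answer seeds" `ω` presenting `O q` (`P.map ans = O q`),
  of the deterministic run against oracles `Or ω` answering `q` by `ans ω`;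
* `SignatureScheme.sigOracleWith S sk ρ` — the deterministic oracle signing every query with the coin
  string `ρ` (cut to the prescribed length), and
  **`SignatureScheme.cmaExp_toReal_eq_uniformAvg_of_le_one`** — for `E ⊆ {≤ 1 query}` and a bound `C`
  on the signing coins, `Pr[E] = 𝔼_{r₀} 𝔼_{r_A} 𝔼_{ρ ∈ {0,1}^C} 1{(pk, queries, run against
  sigOracleWith sk ρ) ∈ E}`. (For coinless signers and arbitrary events see
  `DetSign.cmaExp_toReal_eq_uniformAvg`, `LamportOTSSecurity.lean`.)

## References

* O. Goldreich, *Foundations of Cryptography II: Basic Applications*, CUP 2004, §6.1.3 (the signing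
  oracle), Def. 6.4.2 ("oracle machines that make at most one query"), §6.4.3.3 (proof of
  Prop. 6.4.31).
-/

namespace Literature.Computability.Cryptography

open Filter Asymptotics _root_.Computability Complexity Finset Polynomial

section OracleAlg
open Literature.Computability.Complexity (OracleAlg)
open Literature.Computability.Complexity.OracleAlg

variable {β : Type}

/-- From the transcript `as`, the mass of an event `G` all of whose members record NO (further) query is
the indicator that the deterministic continuation (against any oracle `O'`) lies in `G`: either the next
step outputs (a Dirac law, equal to the deterministic pair), or it queries (and then neither side meets
`G`), or the fuel is out (Dirac at `([], none)`). [Goldreich 2004, Def. 6.4.2] [folklore] -/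
theorem _root_.Literature.Computability.Complexity.OracleAlg.toOuterMeasure_probTranscriptAux_of_nil
    (M : OracleAlg β) (O : List Bool → PMF (List Bool)) (O' : Oracle) (x : List Bool) (k : ℕ) (as : List (List Bool))
    (G : Set (List (List Bool) × Option β)) (hG : ∀ t ∈ G, t.1 = []) [DecidablePred (· ∈ G)] :
    (M.probTranscriptAux O x k as).toOuterMeasure G =
      if (M.queriesAux O' x k as, M.runAux O' x k as) ∈ G then 1 else 0 := by
  cases k with
  | zero =>
    rw [OracleAlg.probTranscriptAux, PMF.toOuterMeasure_pure_apply, OracleAlg.queriesAux, OracleAlg.runAux]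
    split_ifs <;> rfl
  | succ k =>
    rw [OracleAlg.probTranscriptAux, OracleAlg.queriesAux, OracleAlg.runAux]
    cases hs : M.step x as with
    | inr b =>
      simp only [PMF.toOuterMeasure_pure_apply]
      split_ifs <;> rfl
    | inl q =>
      simp only
      rw [PMF.toOuterMeasure_bind_apply, if_neg (fun h => by simpa using hG _ h)]
      refine ENNReal.tsum_eq_zero.2 fun a => ?_
      have hempty : (fun t : List (List Bool) × Option β => (q :: t.1, t.2)) ⁻¹' G = ∅ :=
        Set.preimage_eq_empty (Set.disjoint_left.2 fun t ht hr => by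
          obtain ⟨t', -, rfl⟩ := hr
          simpa using hG _ ht)
      rw [PMF.toOuterMeasure_map_apply, hempty, MeasureTheory.measure_empty, mul_zero]

/-- **At most one query: the mass factors through the first answer.** If every member of `F` records at
most one query and the first step of `M` on `x` is the query `q`, then for every law `P` of seeds `ω`
presenting the first answer's law (`P.map ans = O q`) and every family of oracles `Or ω` answering `q` by
`ans ω`, the mass of `F` under the probabilistic transcript law is the mass of `F` under the push-forward
of `P` by the deterministic run against `Or ω`. [Goldreich 2004, Def. 6.4.2 with §6.1.3] [folklore] -/
theorem _root_.Literature.Computability.Complexity.OracleAlg.toOuterMeasure_probTranscript_of_le_one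
    (M : OracleAlg β) (O : List Bool → PMF (List Bool)) (x : List Bool) (k : ℕ)
    (F : Set (List (List Bool) × Option β)) (hF : ∀ t ∈ F, t.1.length ≤ 1) {q : List Bool}
    (hq : M.step x [] = Sum.inl q) {Ω : Type} (P : PMF Ω) (ans : Ω → List Bool) (Or : Ω → Oracle)
    (hOr : ∀ ω, Or ω q = ans ω) (hP : P.map ans = O q) :
    (M.probTranscript O (k + 1) x).toOuterMeasure F =
      (P.map fun ω => (M.queries (Or ω) (k + 1) x, M.run (Or ω) (k + 1) x)).toOuterMeasure F := by
  classical
  rw [OracleAlg.probTranscript, OracleAlg.probTranscriptAux, hq]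
  simp only
  rw [← hP, PMF.bind_map, PMF.toOuterMeasure_bind_apply,
    show (P.map fun ω => (M.queries (Or ω) (k + 1) x, M.run (Or ω) (k + 1) x)) =
      P.bind (fun ω => PMF.pure (M.queries (Or ω) (k + 1) x, M.run (Or ω) (k + 1) x)) from rfl,
    PMF.toOuterMeasure_bind_apply]
  refine tsum_congr fun ω => ?_
  congr 1
  rw [Function.comp_apply, PMF.toOuterMeasure_map_apply, PMF.toOuterMeasure_pure_apply]
  have hG : ∀ t ∈ (fun t : List (List Bool) × Option β => (q :: t.1, t.2)) ⁻¹' F, t.1 = [] := by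
    intro t ht
    have := hF _ ht
    simp only [List.length_cons] at this
    exact List.eq_nil_of_length_eq_zero (by omega)
  rw [List.nil_append, M.toOuterMeasure_probTranscriptAux_of_nil O (Or ω) x k [ans ω] _ hG]
  simp only [Set.mem_preimage, OracleAlg.queries, OracleAlg.run, OracleAlg.queriesAux, OracleAlg.runAux, hq, hOr ω,
    List.nil_append]

end OracleAlg

/-! ### The chosen-message experiment on one-query events -/

namespace SignatureScheme

/-- The deterministic signing oracle using the coin string `ρ` (cut to the prescribed length) for EVERY
query. On one-query events only its first answer matters. [Goldreich 2004, §6.1.3] [folklore] -/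
def sigOracleWith (S : SignatureScheme) (sk ρ : List Bool) : Oracle :=
  fun q => S.sign.run (sk, q) (ρ.take (S.sign.coinLen (pairCode (sk, q)).length))

/-- A `PMF` push-forward of a uniform coin law evaluates an event as the uniform average of the
indicator (real form). [folklore] -/
theorem toReal_toOuterMeasure_map_uniform_vector {k : ℕ} {γ : Type} (g : List Bool → γ) (E : Set γ)
    [DecidablePred (· ∈ E)] :
    (((PMF.uniformOfFintype (List.Vector Bool k)).map fun v => g v.toList).toOuterMeasure E).toReal =
      uniformAvg k fun r => if g r ∈ E then 1 else 0 := by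
  classical
  rw [PMF.toOuterMeasure_map_apply, PMF.toOuterMeasure_uniformOfFintype_apply, card_vector, Fintype.card_bool,
    SigOWF.uniformAvg_indicator_eq_card, ENNReal.toReal_div]
  simp only [ENNReal.toReal_natCast, ENNReal.toReal_pow, ENNReal.toReal_ofNat, Nat.cast_pow, Nat.cast_ofNat]
  congr 1
  rw [Fintype.card_subtype]
  congr 1
  congr 1
  ext v
  simp only [Finset.mem_filter, Finset.mem_univ, true_and, Set.mem_preimage]

/-- **The chosen-message experiment on one-query events as a triple finite average.** Let every member
of `E` record at most one signing query, and let `C` bound the signing coins `S.sign.coinLen |⟨sk, q⟩|`.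
Then the mass of `E` is the average, over the key-generation coins `r₀`, the forger's coins `r` and a coin
string `ρ ∈ {0,1}^C`, of the indicator that `(pk, queries, output)` of the DETERMINISTIC run of the
forger against `sigOracleWith sk ρ` lies in `E`. [Goldreich 2004, Def. 6.4.2 (at most one query) with
§6.1.3] [folklore] -/
theorem cmaExp_toReal_eq_uniformAvg_of_le_one (S : SignatureScheme) (𝒜 : OracleAdversary (List Bool × List Bool))
    (n : ℕ) (E : Set (List Bool × List (List Bool) × Option (List Bool × List Bool))) [DecidablePred (· ∈ E)]
    (hE : ∀ t ∈ E, t.2.1.length ≤ 1) (C : ℕ) (hC : ∀ sk q : List Bool, S.sign.coinLen (pairCode (sk, q)).length ≤ C) :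
    ((S.cmaExpPMF 𝒜 n).toOuterMeasure E).toReal =
      uniformAvg (S.keyGen.coinLen (unaryEncodeNat n).length) fun r₀ =>
        uniformAvg (𝒜.coins.eval (boolPair (unaryEncodeNat n) (S.keyGen.run n r₀).1).length) fun r =>
          uniformAvg C fun ρ =>
            if ((S.keyGen.run n r₀).1,
                𝒜.alg.queries (S.sigOracleWith (S.keyGen.run n r₀).2 ρ)
                  (𝒜.fuel.eval (boolPair (unaryEncodeNat n) (S.keyGen.run n r₀).1).length)
                  (boolPair (boolPair (unaryEncodeNat n) (S.keyGen.run n r₀).1) r),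
                𝒜.alg.run (S.sigOracleWith (S.keyGen.run n r₀).2 ρ)
                  (𝒜.fuel.eval (boolPair (unaryEncodeNat n) (S.keyGen.run n r₀).1).length)
                  (boolPair (boolPair (unaryEncodeNat n) (S.keyGen.run n r₀).1) r)) ∈ E then 1 else 0 := by
  classical
  set L := S.keyGen.coinLen (unaryEncodeNat n).length with hL
  set Cn : List Bool → ℕ := fun pk => 𝒜.coins.eval (boolPair (unaryEncodeNat n) pk).length with hCn
  set T : List Bool → ℕ := fun pk => 𝒜.fuel.eval (boolPair (unaryEncodeNat n) pk).length with hT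
  -- Step A: for fixed keys and machine input, the mass of the `E`-section is the `ρ`-average
  have hA : ∀ (ks : List Bool × List Bool) (xr : List Bool),
      ((𝒜.alg.probTranscript (fun m => S.sigPMF ks.2 m) (T ks.1) xr).toOuterMeasure
          {t | (ks.1, t) ∈ E}).toReal =
        uniformAvg C fun ρ => if (ks.1, 𝒜.alg.queries (S.sigOracleWith ks.2 ρ) (T ks.1) xr,
          𝒜.alg.run (S.sigOracleWith ks.2 ρ) (T ks.1) xr) ∈ E then 1 else 0 := by
    intro ks xr
    rcases hk : T ks.1 with _ | k
    · -- no fuel: both sides are the indicator of `([], none)`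
      rw [OracleAlg.probTranscript, OracleAlg.probTranscriptAux, PMF.toOuterMeasure_pure_apply]
      have hconst : (fun ρ : List Bool => if (ks.1, 𝒜.alg.queries (S.sigOracleWith ks.2 ρ) 0 xr,
          𝒜.alg.run (S.sigOracleWith ks.2 ρ) 0 xr) ∈ E then (1 : ℝ) else 0) =
          fun _ => if (ks.1, ([] : List (List Bool)), (none : Option (List Bool × List Bool))) ∈ E then 1 else 0 := by
        funext ρ; rfl
      rw [hconst, SigOWF.uniformAvg_const']
      simp only [Set.mem_setOf_eq]
      split_ifs <;> simp
    · cases hs : 𝒜.alg.step xr [] with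
      | inr b =>
        -- immediate output: both sides are the indicator of `([], some b)`
        rw [OracleAlg.probTranscript, OracleAlg.probTranscriptAux, hs]
        simp only [PMF.toOuterMeasure_pure_apply]
        have hconst : (fun ρ : List Bool => if (ks.1, 𝒜.alg.queries (S.sigOracleWith ks.2 ρ) (k + 1) xr,
            𝒜.alg.run (S.sigOracleWith ks.2 ρ) (k + 1) xr) ∈ E then (1 : ℝ) else 0) =
            fun _ => if (ks.1, ([] : List (List Bool)), some b) ∈ E then 1 else 0 := by
          funext ρ
          simp only [OracleAlg.queries, OracleAlg.run, OracleAlg.queriesAux, OracleAlg.runAux, hs]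
        rw [hconst, SigOWF.uniformAvg_const']
        simp only [Set.mem_setOf_eq]
        split_ifs <;> simp
      | inl q =>
        -- a first query `q`: factor through the coins of its signature, then pad the coins to `C`
        set cS := S.sign.coinLen (pairCode (ks.2, q)).length with hcS
        have hP : (PMF.uniformOfFintype (List.Vector Bool C)).map
            (fun v => S.sign.run (ks.2, q) (v.toList.take cS)) = S.sigPMF ks.2 q := by
          have h1 : (fun v : List.Vector Bool C => S.sign.run (ks.2, q) (v.toList.take cS)) =
              S.sign.run (ks.2, q) ∘ fun v : List.Vector Bool C => v.toList.take cS := rfl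
          rw [h1, ← PMF.map_comp, MetaComplexity.map_take_uniformOfFintype_vector (hC ks.2 q), PMF.map_comp]
          rfl
        rw [OracleAlg.toOuterMeasure_probTranscript_of_le_one 𝒜.alg _ xr k {t | (ks.1, t) ∈ E}
          (fun t ht => hE _ ht) hs (PMF.uniformOfFintype (List.Vector Bool C))
          (fun v => S.sign.run (ks.2, q) (v.toList.take cS)) (fun v => S.sigOracleWith ks.2 v.toList) (fun v => rfl) hP]
        rw [toReal_toOuterMeasure_map_uniform_vector
          (fun ρ => (𝒜.alg.queries (S.sigOracleWith ks.2 ρ) (k + 1) xr, 𝒜.alg.run (S.sigOracleWith ks.2 ρ) (k + 1) xr))]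
        rfl
  -- Step B: average over the key-generation coins and the forger's coins
  set G : List Bool × List Bool → PMF (List Bool × List (List Bool) × Option (List Bool × List Bool)) :=
    fun ks => (𝒜.probTranscriptPMF (fun m => S.sigPMF ks.2 m) (boolPair (unaryEncodeNat n) ks.1)).map
      fun t => (ks.1, t) with hG
  have hexp : S.cmaExpPMF 𝒜 n = (PMF.uniformOfFintype (List.Vector Bool L)).bind (G ∘ fun v => S.keyGen.run n v.toList) := by
    rw [SignatureScheme.cmaExpPMF, SignatureScheme.keyPMF, RandAlg.outputPMF, PMF.bind_map]
  have hGE : ∀ ks : List Bool × List Bool, ((G ks).toOuterMeasure E).toReal =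
      uniformAvg (Cn ks.1) fun r => uniformAvg C fun ρ =>
        if (ks.1, 𝒜.alg.queries (S.sigOracleWith ks.2 ρ) (T ks.1) (boolPair (boolPair (unaryEncodeNat n) ks.1) r),
          𝒜.alg.run (S.sigOracleWith ks.2 ρ) (T ks.1) (boolPair (boolPair (unaryEncodeNat n) ks.1) r)) ∈ E then 1 else 0 := by
    intro ks
    rw [hG]
    simp only
    rw [PMF.toOuterMeasure_map_apply, OracleAdversary.probTranscriptPMF, PMF.toOuterMeasure_bind_apply, tsum_fintype,
      ENNReal.toReal_sum (fun v _ => ?_), SigOWF.uniformAvg_eq_sum_div]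
    · refine Finset.sum_congr rfl fun v _ => ?_
      rw [ENNReal.toReal_mul, PMF.uniformOfFintype_apply, card_vector, Fintype.card_bool, ENNReal.toReal_inv]
      simp only [ENNReal.toReal_pow, ENNReal.toReal_ofNat, Nat.cast_pow, Nat.cast_ofNat]
      rw [show (fun t : List (List Bool) × Option (List Bool × List Bool) => (ks.1, t)) ⁻¹' E = {t | (ks.1, t) ∈ E} from rfl,
        hA ks, div_eq_inv_mul]
    · refine ENNReal.mul_ne_top ?_ ?_
      · rw [PMF.uniformOfFintype_apply]
        exact ENNReal.inv_ne_top.2 (by exact_mod_cast Fintype.card_ne_zero)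
      · exact ne_top_of_le_ne_top ENNReal.one_ne_top (pmf_toOuterMeasure_apply_le_one _ _)
  rw [hexp, PMF.toOuterMeasure_bind_apply, tsum_fintype, ENNReal.toReal_sum (fun v _ => ?_), SigOWF.uniformAvg_eq_sum_div]
  · refine Finset.sum_congr rfl fun v _ => ?_
    rw [ENNReal.toReal_mul, Function.comp_apply, hGE, PMF.uniformOfFintype_apply, card_vector, Fintype.card_bool,
      ENNReal.toReal_inv]
    simp only [ENNReal.toReal_pow, ENNReal.toReal_ofNat, Nat.cast_pow, Nat.cast_ofNat]
    rw [div_eq_inv_mul]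
  · refine ENNReal.mul_ne_top ?_ ?_
    · rw [PMF.uniformOfFintype_apply]
      exact ENNReal.inv_ne_top.2 (by exact_mod_cast Fintype.card_ne_zero)
    · exact ne_top_of_le_ne_top ENNReal.one_ne_top (pmf_toOuterMeasure_apply_le_one _ _)

end SignatureScheme

end Literature.Computability.Cryptography
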